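import Mathlib
import Summits.AtomisticToContinuum.HydrodynamicLimit.Theorems.InformationPercolationEngineKickFairRelEquilibriumMesoConditionThePastDefs
import Summits.AtomisticToContinuum.HydrodynamicLimit.Theorems.InformationPercolationEngineKickFairRelEquilibriumMesoTransferAE
import Summits.AtomisticToContinuum.HydrodynamicLimit.Theorems.InformationPercolationEngineKickFairRelEquilibriumMesoTransferSlots
import Summits.AtomisticToContinuum.HydrodynamicLimit.Theorems.InformationPercolationEngineKickFairRelEquilibriumMesoPastMeasurable
import Summits.AtomisticToContinuum.HydrodynamicLimit.Theorems.InformationPercolationEngineKickFairRelEquilibriumMesoReductionBSetup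
import Summits.AtomisticToContinuum.HydrodynamicLimit.Theorems.InformationPercolationEngineKickFairRelEquilibriumMesoReductionB
import Summits.AtomisticToContinuum.HydrodynamicLimit.Theorems.KickFairRelEquilibriumMeso.Negative.WindowAlgebra
import Literature.MathematicalPhysics.KineticTheory.LocalGibbsConstEquivalence
import HarnessLib

/-!
# `KickFairRelEquilibriumMeso`, line `condition-the-past` — NECESSITY of B1:
# `singleKickBias_of_mesoBody : MesoBody rs → SingleKickBias rs`

Prover file (`--supports stmt-AtomisticToContinuum-15177`) for the registered sub-goal `singleKickBias_of_mesoBody` of the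
checked skeleton `Cruxes/KickFairRelEquilibriumMeso/Lines/condition_the_past.lean` (rev 2, lead c7) of the crux
`Summit.AtomisticToContinuum.HydrodynamicLimit.Theses.InformationPercolationEngine.KickFairRelEquilibriumMeso`.
It certifies in Lean that the single-kick conditional bias statement B1 (`SingleKickBias rs`, the Campbell-`L¹(LG)` mass of
`β_{i,n} = E_{LG}[D_{i,n} | σ(P_{i,n})]`) is IMPLIED by the body of the crux along the same cell sequence (`MesoBody rs`):
B1 is the necessary core of the crux, which licenses the planner's split of the node at B1.

Argument (fixed `N`, `σ ≤ 1/2`, `LG` the local Gibbs law, `c = ε/(N+1)`). (a) Doob–Dynkin: `β_{i,n}` is strongly measurable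
for the comap σ-algebra of the typed past, hence `β_{i,n} = b_{i,n} ∘ P_{i,n}` for a Borel `b_{i,n}` on `Past N`
(`StronglyMeasurable.exists_eq_measurable_comp`). (b) Feed the body of the crux the admissible weight
`h_{i,n}(p) = 1_{n<M} · sgn b_{i,n}(p)` (measurable, `|h| ≤ 1`). (c) KEY IDENTITY
`∫ S_h dLG = ∫ c Σ_i Σ_{n<cnt_i} 1_{n<M} |β_{i,n}| dLG`: the cut `1_{n<cnt_i}` is `LG`-a.e. the past-measurable indicator
`1_{t_{i,n} ∈ (0,τ]}` (`ae_forall_lt_cnt_iff_pastTime`), so `S_h` is a.e. a FINITE sum `c Σ_i Σ_{n<M} W_{i,n} D_{i,n}` with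
`W_{i,n}` a bounded `σ(P_{i,n})`-measurable weight, and termwise `∫ W D = ∫ W E_{LG}[D | σ(P)] = ∫ W β` (tower + pull-out:
`integral_condExp`, `condExp_mul_of_stronglyMeasurable_left`), while `W β = 1_{t ∈ (0,τ]} |β|` pointwise. (d) Hence
`∫ c ΣΣ 1_{n<M} |β| = ∫ S_h ≤ ∫ |S_h| ≤ δ` (`KickBoundRel … = ∫⁻ ofReal |fullSum …| ≤ ofReal δ` definitionally).
(e) `M → ∞` by monotone convergence (`lintegral_tendsto_of_tendsto_of_monotone`; the truncated integrands are eventually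
equal to the B1 integrand pointwise).
-/

noncomputable section

open MeasureTheory Set Filter Topology
open scoped ENNReal Classical

namespace Summit.AtomisticToContinuum.HydrodynamicLimit.Theorems.KickFairRelEquilibriumMesoLine

open Literature.Analysis.FluidPDE Literature.MathematicalPhysics.KineticTheory
open Summit.AtomisticToContinuum.HydrodynamicLimit.Theorems.KickFairRelEquilibriumMesoNegative
  (KickBoundRel MesoBody)

/-! ## Generic lemmas -/

section Generic

variable {Ω : Type*} {m m0 : MeasurableSpace Ω} {μ : Measure[m0] Ω}

/-- **Tower + pull-out**: for `m ≤ m0`, an `m`-strongly-measurable weight `|W| ≤ 1` and an integrable `D`,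
`∫ W D = ∫ W μ[D|m]`. [folklore] -/
theorem integral_mul_eq_integral_mul_condExp [IsFiniteMeasure μ] (hm : m ≤ m0) {W D : Ω → ℝ}
    (hW : StronglyMeasurable[m] W) (hWb : ∀ ω, |W ω| ≤ 1) (hD : Integrable D μ) :
    ∫ ω, W ω * D ω ∂μ = ∫ ω, W ω * (μ[D|m]) ω ∂μ := by
  have hWD : Integrable (W * D) μ := Integrable.bdd_mul (c := 1) hD (hW.mono hm).aestronglyMeasurable
    (Eventually.of_forall fun ω => by simpa [Real.norm_eq_abs] using hWb ω)
  calc ∫ ω, W ω * D ω ∂μ = ∫ ω, (W * D) ω ∂μ := rfl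
    _ = ∫ ω, (μ[W * D|m]) ω ∂μ := (integral_condExp hm).symm
    _ = ∫ ω, (W * μ[D|m]) ω ∂μ := integral_congr_ae (condExp_mul_of_stronglyMeasurable_left hW hWD hD)
    _ = ∫ ω, W ω * (μ[D|m]) ω ∂μ := rfl

end Generic

/-! ## The estimate at fixed `N` -/

section FixedN

variable {σ : ℝ} {N : ℕ} {a₀ θ₀ : T3 → ℝ} {u₀ : T3 → V3}

/-- **Necessity of B1 at fixed `N`.** For `0 < σ ≤ 1/2`, a finite local Gibbs law, continuous `|g| ≤ C` and `0 ≤ δ`: if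
`E_{LG}|S_h| ≤ δ` for EVERY measurable weight `|h| ≤ 1` of the typed past, then `E_{LG}[(ε/(N+1)) Σ_i Σ_{n<cnt_i} |β_{i,n}|] ≤ δ`
(sign weight of a Doob–Dynkin version of `β`, truncated at `n < M`; tower/pull-out; `M → ∞`). [folklore] -/
theorem lintegral_bias_le_of_body (hσ : 0 < σ) (hσ2 : σ ≤ 1 / 2) (Φ : Flow σ N)
    [IsFiniteMeasure (localGibbsLaw σ a₀ u₀ θ₀ N Φ)] (τ r : ℝ) {g : V3 × V3 × V3 → ℝ} (hg : Continuous g)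
    {C : ℝ} (hC : ∀ p, |g p| ≤ C) {δ : ℝ} (hδ : 0 ≤ δ)
    (H : ∀ h : Fin (N + 1) → ℕ → Past N → ℝ, (∀ i n, Measurable (h i n)) → (∀ i n p, |h i n p| ≤ 1) →
      ∫⁻ z, ENNReal.ofReal |fullSum Φ τ r g h z| ∂(localGibbsLaw σ a₀ u₀ θ₀ N Φ) ≤ ENNReal.ofReal δ) :
    ∫⁻ z, ENNReal.ofReal (hsDiameter σ N / ((N : ℝ) + 1) *
        ∑ i : Fin (N + 1), ∑ n ∈ Finset.range (cnt Φ τ z i), |betaLG σ a₀ θ₀ u₀ Φ r g i n z|)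
      ∂(localGibbsLaw σ a₀ u₀ θ₀ N Φ) ≤ ENNReal.ofReal δ := by
  set LG := localGibbsLaw σ a₀ u₀ θ₀ N Φ with hLG
  set c : ℝ := hsDiameter σ N / ((N : ℝ) + 1) with hc
  have hc0 : 0 ≤ c := div_nonneg (hsDiameter_pos hσ N).le (by positivity)
  set β : Fin (N + 1) → ℕ → Phase N → ℝ := fun i n => betaLG σ a₀ θ₀ u₀ Φ r g i n with hβ
  -- (a) Doob–Dynkin versions of `β` on the past
  have hDD : ∀ (i : Fin (N + 1)) (n : ℕ), ∃ b : Past N → ℝ, Measurable b ∧ β i n = b ∘ fun z => past Φ r z i n := by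
    intro i n
    have hsm : StronglyMeasurable[pastSA Φ r i n] (β i n) := stronglyMeasurable_condExp
    obtain ⟨b, hbm, hb⟩ := hsm.exists_eq_measurable_comp
    exact ⟨b, hbm.measurable, hb⟩
  choose b hbm hbeq using hDD
  -- (b) the sign weight `s = sgn b` on the past, and `W_{i,n} = 1_{t_{i,n} ∈ (0,τ]} s_{i,n}(P_{i,n})`
  obtain ⟨s, hs⟩ : ∃ s : Fin (N + 1) → ℕ → Past N → ℝ, ∀ i n p, s i n p = if 0 ≤ b i n p then 1 else -1 :=
    ⟨_, fun _ _ _ => rfl⟩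
  have hsm : ∀ i n, Measurable (s i n) := fun i n => by
    rw [show s i n = fun p => if 0 ≤ b i n p then (1 : ℝ) else -1 from funext (hs i n)]
    exact Measurable.ite (measurableSet_le measurable_const (hbm i n)) measurable_const measurable_const
  have hsb : ∀ i n p, |s i n p| ≤ 1 := fun i n p => by
    rw [hs]; split_ifs <;> simp
  have hsabs : ∀ i n p, s i n p * b i n p = |b i n p| := fun i n p => by
    rw [hs]
    split_ifs with h
    · rw [one_mul, abs_of_nonneg h]
    · rw [neg_one_mul, abs_of_neg (not_le.1 h)]
  have hWβ : ∀ (i : Fin (N + 1)) (n : ℕ) (z : Phase N), wt Φ τ r s i n z * β i n z =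
      (if (past Φ r z i n).2.2.2 ∈ Set.Ioc 0 τ then (1 : ℝ) else 0) * |β i n z| := by
    intro i n z
    have h1 : β i n z = b i n (past Φ r z i n) := congrFun (hbeq i n) z
    show wtFun τ s i n (past Φ r z i n) * β i n z = _
    unfold wtFun
    rw [mul_assoc, h1, hsabs]
  have hWβ0 : ∀ (i : Fin (N + 1)) (n : ℕ) (z : Phase N), 0 ≤ wt Φ τ r s i n z * β i n z := by
    intro i n z
    rw [hWβ]
    exact mul_nonneg (by split_ifs <;> norm_num) (abs_nonneg _)
  -- integrability of the terms
  have hDi : ∀ (i : Fin (N + 1)) (n : ℕ), Integrable (kickDev Φ r g i n) LG := fun i n =>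
    integrable_of_ae_abs_le (measurable_kickDev Φ r hg i n).aestronglyMeasurable
      ((ae_forall_abs_kickDev_le (a₀ := a₀) (θ₀ := θ₀) (u₀ := u₀) hσ2 Φ r hC).mono fun _ hz => hz i n)
  have hPi : ∀ (i : Fin (N + 1)) (n : ℕ), Integrable (fun z => wt Φ τ r s i n z * kickDev Φ r g i n z) LG :=
    fun i n => Integrable.bdd_mul (c := 1) (hDi i n) (measurable_wt Φ τ r hsm i n).aestronglyMeasurable
      (Eventually.of_forall fun z => by simpa [Real.norm_eq_abs] using abs_wt_le_one Φ τ r hsb i n z)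
  have hQi : ∀ (i : Fin (N + 1)) (n : ℕ), Integrable (fun z => wt Φ τ r s i n z * β i n z) LG :=
    fun i n => Integrable.bdd_mul (c := 1) integrable_condExp (measurable_wt Φ τ r hsm i n).aestronglyMeasurable
      (Eventually.of_forall fun z => by simpa [Real.norm_eq_abs] using abs_wt_le_one Φ τ r hsb i n z)
  -- (c) the pull-out, termwise: `∫ W D = ∫ W β`
  have hpull : ∀ (i : Fin (N + 1)) (n : ℕ), ∫ z, wt Φ τ r s i n z * kickDev Φ r g i n z ∂LG =
      ∫ z, wt Φ τ r s i n z * β i n z ∂LG := fun i n =>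
    integral_mul_eq_integral_mul_condExp (pastSA_le Φ r i n) (stronglyMeasurable_wt Φ r τ hsm i n)
      (abs_wt_le_one Φ τ r hsb i n) (hDi i n)
  -- the genuine cut, a.e.
  have hcut := ae_forall_lt_cnt_iff_pastTime (a₀ := a₀) (θ₀ := θ₀) (u₀ := u₀) hσ2 Φ τ r
  -- the truncated integrands and their bound
  have hM : ∀ M : ℕ,
      AEMeasurable (fun z => ENNReal.ofReal (c * ∑ i : Fin (N + 1), ∑ n ∈ Finset.range (cnt Φ τ z i),
        (if n < M then (1 : ℝ) else 0) * |β i n z|)) LG ∧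
      ∫⁻ z, ENNReal.ofReal (c * ∑ i : Fin (N + 1), ∑ n ∈ Finset.range (cnt Φ τ z i),
        (if n < M then (1 : ℝ) else 0) * |β i n z|) ∂LG ≤ ENNReal.ofReal δ := by
    intro M
    -- the admissible weight `w = 1_{n<M} s` fed to the body of the crux
    obtain ⟨w, hw⟩ : ∃ w : Fin (N + 1) → ℕ → Past N → ℝ, ∀ i n p,
        w i n p = (if n < M then (1 : ℝ) else 0) * s i n p := ⟨_, fun _ _ _ => rfl⟩
    have hwm : ∀ i n, Measurable (w i n) := fun i n => by
      rw [show w i n = fun p => (if n < M then (1 : ℝ) else 0) * s i n p from funext (hw i n)]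
      exact (hsm i n).const_mul _
    have hwb : ∀ i n p, |w i n p| ≤ 1 := fun i n p => by
      rw [hw]
      by_cases h : n < M
      · rw [if_pos h, one_mul]; exact hsb i n p
      · rw [if_neg h, zero_mul, abs_zero]; exact zero_le_one
    -- the finite pivots `P = c ΣΣ_{n<M} W D`, `Q = c ΣΣ_{n<M} W β`
    have hPint : Integrable (fun z => c * ∑ i : Fin (N + 1), ∑ n ∈ Finset.range M,
        wt Φ τ r s i n z * kickDev Φ r g i n z) LG :=
      (integrable_finsetSum _ fun i _ => integrable_finsetSum _ fun n _ => hPi i n).const_mul c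
    have hQint : Integrable (fun z => c * ∑ i : Fin (N + 1), ∑ n ∈ Finset.range M,
        wt Φ τ r s i n z * β i n z) LG :=
      (integrable_finsetSum _ fun i _ => integrable_finsetSum _ fun n _ => hQi i n).const_mul c
    have hPQ : ∫ z, c * ∑ i : Fin (N + 1), ∑ n ∈ Finset.range M, wt Φ τ r s i n z * kickDev Φ r g i n z ∂LG =
        ∫ z, c * ∑ i : Fin (N + 1), ∑ n ∈ Finset.range M, wt Φ τ r s i n z * β i n z ∂LG := by
      rw [integral_const_mul, integral_const_mul,
        integral_finsetSum _ fun i _ => integrable_finsetSum _ fun n _ => hPi i n,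
        integral_finsetSum _ fun i _ => integrable_finsetSum _ fun n _ => hQi i n]
      refine congrArg (c * ·) (Finset.sum_congr rfl fun i _ => ?_)
      rw [integral_finsetSum _ fun n _ => hPi i n, integral_finsetSum _ fun n _ => hQi i n]
      exact Finset.sum_congr rfl fun n _ => hpull i n
    -- (c1) `S_h = P` a.e. for the truncated sign weight
    have hfull : ∀ᵐ z ∂LG, fullSum Φ τ r g w z =
        c * ∑ i : Fin (N + 1), ∑ n ∈ Finset.range M, wt Φ τ r s i n z * kickDev Φ r g i n z := by
      filter_upwards [hcut] with z hz
      unfold fullSum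
      rw [← hc]
      refine congrArg (c * ·) (Finset.sum_congr rfl fun i _ => ?_)
      have h1 : ∀ n : ℕ, w i n (past Φ r z i n) * (g (kick Φ i n z) - kappa Φ r g i n z) =
          (if n < M then (1 : ℝ) else 0) * (s i n (past Φ r z i n) * kickDev Φ r g i n z) := by
        intro n
        simp only [hw, kickDev, mul_assoc]
      simp_rw [h1]
      rw [sum_range_ite_lt_comm]
      refine Finset.sum_congr rfl fun n _ => ?_
      unfold wt wtFun
      simp only [hz i n, mul_assoc]
    -- (c2) the truncated B1 integrand is `Q` a.e.
    have htrunc : ∀ᵐ z ∂LG, c * ∑ i : Fin (N + 1), ∑ n ∈ Finset.range (cnt Φ τ z i),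
        (if n < M then (1 : ℝ) else 0) * |β i n z| =
        c * ∑ i : Fin (N + 1), ∑ n ∈ Finset.range M, wt Φ τ r s i n z * β i n z := by
      filter_upwards [hcut] with z hz
      refine congrArg (c * ·) (Finset.sum_congr rfl fun i _ => ?_)
      rw [sum_range_ite_lt_comm]
      refine Finset.sum_congr rfl fun n _ => ?_
      rw [hWβ i n z]
      simp only [hz i n]
    -- (d) `∫ Q = ∫ P = ∫ S_h ≤ ∫ |S_h| ≤ δ`
    have hSint : Integrable (fullSum Φ τ r g w) LG := hPint.congr (hfull.mono fun z hz => hz.symm)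
    have hSabs : ∫ z, |fullSum Φ τ r g w z| ∂LG ≤ δ :=
      integral_le_of_lintegral_ofReal_le (Eventually.of_forall fun z => abs_nonneg _) hSint.abs.aestronglyMeasurable
        (Eventually.of_forall fun z => le_rfl) (H w hwm hwb) hδ
    have hQle : ∫ z, c * ∑ i : Fin (N + 1), ∑ n ∈ Finset.range M, wt Φ τ r s i n z * β i n z ∂LG ≤ δ := by
      rw [← hPQ, ← integral_congr_ae hfull]
      exact (integral_mono hSint hSint.abs fun z => le_abs_self _).trans hSabs
    have hQ0 : 0 ≤ᵐ[LG] fun z => c * ∑ i : Fin (N + 1), ∑ n ∈ Finset.range M, wt Φ τ r s i n z * β i n z :=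
      Eventually.of_forall fun z => mul_nonneg hc0
        (Finset.sum_nonneg fun i _ => Finset.sum_nonneg fun n _ => hWβ0 i n z)
    refine ⟨?_, ?_⟩
    · refine (hQint.aestronglyMeasurable.aemeasurable.ennreal_ofReal).congr ?_
      filter_upwards [htrunc] with z hz
      exact congrArg ENNReal.ofReal hz.symm
    · calc ∫⁻ z, ENNReal.ofReal (c * ∑ i : Fin (N + 1), ∑ n ∈ Finset.range (cnt Φ τ z i),
              (if n < M then (1 : ℝ) else 0) * |β i n z|) ∂LG
          = ∫⁻ z, ENNReal.ofReal (c * ∑ i : Fin (N + 1), ∑ n ∈ Finset.range M,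
              wt Φ τ r s i n z * β i n z) ∂LG :=
            lintegral_congr_ae (htrunc.mono fun z hz => congrArg ENNReal.ofReal hz)
        _ = ENNReal.ofReal (∫ z, c * ∑ i : Fin (N + 1), ∑ n ∈ Finset.range M,
              wt Φ τ r s i n z * β i n z ∂LG) := (ofReal_integral_eq_lintegral_ofReal hQint hQ0).symm
        _ ≤ ENNReal.ofReal δ := ENNReal.ofReal_le_ofReal hQle
  -- (e) `M → ∞`: the truncated integrands increase to the B1 integrand pointwise (eventually equal)
  have hmono : ∀ z : Phase N, Monotone fun M : ℕ => ENNReal.ofReal (c * ∑ i : Fin (N + 1),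
      ∑ n ∈ Finset.range (cnt Φ τ z i), (if n < M then (1 : ℝ) else 0) * |β i n z|) := by
    intro z M M' hMM'
    refine ENNReal.ofReal_le_ofReal (mul_le_mul_of_nonneg_left ?_ hc0)
    refine Finset.sum_le_sum fun i _ => Finset.sum_le_sum fun n _ => ?_
    refine mul_le_mul_of_nonneg_right ?_ (abs_nonneg _)
    by_cases h1 : n < M
    · rw [if_pos h1, if_pos (h1.trans_le hMM')]
    · rw [if_neg h1]; split_ifs <;> norm_num
  have htend : ∀ z : Phase N, Tendsto (fun M : ℕ => ENNReal.ofReal (c * ∑ i : Fin (N + 1),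
      ∑ n ∈ Finset.range (cnt Φ τ z i), (if n < M then (1 : ℝ) else 0) * |β i n z|)) atTop
      (𝓝 (ENNReal.ofReal (c * ∑ i : Fin (N + 1), ∑ n ∈ Finset.range (cnt Φ τ z i), |β i n z|))) := by
    intro z
    refine tendsto_atTop_of_eventually_const (i₀ := Finset.univ.sup (cnt Φ τ z)) fun M hM => ?_
    refine congrArg ENNReal.ofReal (congrArg (c * ·) ?_)
    refine Finset.sum_congr rfl fun i _ => Finset.sum_congr rfl fun n hn => ?_
    rw [if_pos (lt_of_lt_of_le (Finset.mem_range.1 hn) ((Finset.le_sup (Finset.mem_univ i)).trans hM)), one_mul]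
  exact le_of_tendsto' (lintegral_tendsto_of_tendsto_of_monotone (fun M => (hM M).1)
    (Eventually.of_forall hmono) (Eventually.of_forall htend)) fun M => (hM M).2

end FixedN

/-! ## The registered sub-goal -/

/-- **NECESSITY OF B1 — `singleKickBias_of_mesoBody` (registered sub-goal of the line `condition-the-past`).**
The body of the crux along the cell sequence `rs` (`MesoBody rs`: `E_{LG}|S_h| ≤ δ` eventually in `N`, uniformly over
measurable weights `|h| ≤ 1` of the typed past) implies the single-kick conditional bias statement B1
(`SingleKickBias rs`: `E_{LG}[(ε/(N+1)) Σ_i Σ_{n<cnt_i} |β_{i,n}|] ≤ δ` eventually), with the same thresholds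
(`σ₀ := min σ₀ (1/2)`, same `N₀`): at each `N ≥ N₀` test the body with the sign weight of a Doob–Dynkin version of `β`
(`lintegral_bias_le_of_body`). So B1 is the necessary core of the crux. [folklore] -/
theorem singleKickBias_of_mesoBody : MesoBody rs → SingleKickBias rs := by
  intro hMB a₀ θ₀ u₀ ha hθ hu ha0 hθ0
  obtain ⟨σ₁, hσ₁, H⟩ := hMB a₀ θ₀ u₀ ha hθ hu ha0 hθ0
  refine ⟨min σ₁ (1 / 2), lt_min hσ₁ (by norm_num), ?_⟩
  intro σ hσ hσlt Φ τ hτ g hg hgb δ hδ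
  have hσ1 : σ < σ₁ := hσlt.trans_le (min_le_left _ _)
  have hσ2 : σ ≤ 1 / 2 := (hσlt.trans_le (min_le_right _ _)).le
  obtain ⟨C, hC⟩ := hgb
  obtain ⟨N₀, hN₀⟩ := H σ hσ hσ1 Φ τ hτ g hg ⟨C, hC⟩ δ hδ
  refine ⟨N₀, fun N hN => ?_⟩
  haveI : IsProbabilityMeasure (localGibbsLaw σ a₀ u₀ θ₀ N (Φ N)) :=
    isProbabilityMeasure_localGibbsLaw ha hθ hu ha0 hθ0 hσ2 N (Φ N)
  refine lintegral_bias_le_of_body hσ hσ2 (Φ N) τ (rs N) hg hC hδ.le fun h hhm hhb => ?_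
  have hK := hN₀ N hN h hhm hhb
  change ∫⁻ z, ENNReal.ofReal |fullSum (Φ N) τ (rs N) g h z| ∂(localGibbsLaw σ a₀ u₀ θ₀ N (Φ N)) ≤
    ENNReal.ofReal δ at hK
  exact hK

end Summit.AtomisticToContinuum.HydrodynamicLimit.Theorems.KickFairRelEquilibriumMesoLine

end
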